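import Mathlib
import Literature.NumberTheory.LFunctions.WeilGroundState
import Literature.NumberTheory.LFunctions.WeilGroundStateRealZerosProofs
import Summits.RiemannHypothesis.RiemannHypothesis.Theorems.WeilGroundStateGroundStateSimpleEvenStubIntertwineKernel
import Summits.RiemannHypothesis.RiemannHypothesis.Theorems.WeilGroundStateGroundStateSimpleEvenStubOddPrimitive
import Summits.RiemannHypothesis.RiemannHypothesis.Theorems.WeilGroundStateGroundStateSimpleEvenStubPairContinuityPolarPrime
import Summits.RiemannHypothesis.RiemannHypothesis.Theorems.WeilGroundStateGroundStateSimpleEvenStubPairContinuityArch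
import HarnessLib

/-!
# Crux `GroundStateSimpleEven` (stmt-RiemannHypothesis-1526), line `parity-multiplicity-commutator`
# (v2), stub PAIR — preliminaries: pair continuity of the Weil form; the window primitive is non-zero

Support file (`--supports stmt-RiemannHypothesis-1526`) proving the registered sub-goals
`stub_pairContinuity` and `stub_windowPrimitive_ne_zero` of the v2 skeleton verbatim (helpers of
the stub PAIR `stub_oddMinimisers_of_evenPair`), from the landed sub-goals (PC1)
`stub_pairContinuity_polarPrime` (p135583) and (PC2) `stub_pairContinuity_arch` (p135667).  Normalisation of
`Literature/NumberTheory/LFunctions/WeilExplicit.lean`: `W = weilFunctional`, `Q g = W(g ⋆ g̃)`,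
`g̃ = weilReflect g`, `⋆ = weilConv`, `ε = ε(a) = weilGroundEnergy a`,
`q(f) = Re Q(f) − ε ∫|f|²` (`≥ 0` on window test functions).

## Contents

* §1 **Pair continuity** (`exists_norm_weilFunctional_pair_le`, registered as `stub_pairContinuity`):
  `‖W(f ⋆ h̃)‖ ≤ C ‖f‖₂ (‖h‖₂ + ‖h'‖₂)` for window test functions `f, h`, from (PC1) + (PC2) and
  `W = polar − prime + (2π)⁻¹·arch − K(0) log π`: the Weil form is of logarithmic order, hence
  bounded on `L² × H¹` of the window (boundary values are invisible to it).
* §2 **The window primitive is non-zero** (`integral_norm_sq_primitive_pos`, registered as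
  `stub_windowPrimitive_ne_zero`): for ground states `u₁ ⊥ u₂`, `(c₁, c₂) ≠ 0` and
  `∫ (c₂u₁ − c₁u₂) = 0`, the window primitive `U = ∫_{-a}^t (c₂u₁ − c₁u₂)` has `∫|U|² > 0`
  (otherwise all interval integrals of `c₂u₁ − c₁u₂` vanish, `c₂u₁ = c₁u₂` a.e., impossible for
  an orthonormal pair).

Mathlib + proved tree files only; no definitions, no named facts.
-/

noncomputable section

open Set MeasureTheory Filter Complex
open scoped Real Topology ComplexConjugate

namespace Summit.RiemannHypothesis.RiemannHypothesis.Theorems.GroundStateSimpleEven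

open Literature.NumberTheory.LFunctions

-- `linter.dupNamespace` off: the mandated namespace `Summit.RiemannHypothesis.RiemannHypothesis.…`
-- (single-problem summit) repeats a component.
set_option linter.dupNamespace false

/-! ## §1. Pair continuity of the Weil form on `L² × H¹` of the window -/

section PairContinuity

variable {a : ℝ}

/-- **Pair continuity.** For `a > 0` there is `C ≥ 0` with
`‖W(f ⋆ h̃)‖ ≤ C ‖f‖₂ (‖h‖₂ + ‖h'‖₂)` for all window test functions `f, h`: the Weil form is of
logarithmic order, hence bounded on `L² × H¹` of the window (polar and prime part and `K(0)` are
`L² × L²`-bounded, (PC1); the archimedean integral is `L² × H¹`-bounded, (PC2); and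
`W = polar − prime + (2π)⁻¹ arch − K(0) log π`). [folklore] -/
theorem exists_norm_weilFunctional_pair_le (ha : 0 < a) :
    ∃ C : ℝ, 0 ≤ C ∧ ∀ f h : ℝ → ℂ, IsWeilTest f → tsupport f ⊆ Icc (-a) a →
      IsWeilTest h → tsupport h ⊆ Icc (-a) a →
        ‖weilFunctional (weilConv f (weilReflect h))‖ ≤
          C * √(∫ t, ‖f t‖ ^ 2) * (√(∫ t, ‖h t‖ ^ 2) + √(∫ t, ‖deriv h t‖ ^ 2)) := by
  obtain ⟨C₁, hC₁, h₁⟩ := stub_pairContinuity_polarPrime a ha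
  obtain ⟨C₂, hC₂, h₂⟩ := stub_pairContinuity_arch a ha
  refine ⟨4 * C₁ + C₂, by positivity, fun f h hf hfs hh hhs ↦ ?_⟩
  set K : ℝ → ℂ := weilConv f (weilReflect h) with hK
  set S : ℝ := √(∫ t, ‖f t‖ ^ 2) with hS
  set N : ℝ := √(∫ t, ‖h t‖ ^ 2) with hN
  set N' : ℝ := √(∫ t, ‖deriv h t‖ ^ 2) with hN'
  have hS0 : 0 ≤ S := Real.sqrt_nonneg _
  have hN0 : 0 ≤ N := Real.sqrt_nonneg _
  have hN'0 : 0 ≤ N' := Real.sqrt_nonneg _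
  have hPP := h₁ f h hf hfs hh hhs
  have hA := h₂ f h hf hfs hh hhs
  have hlogπ : ‖(Real.log π : ℂ)‖ ≤ 3 := by
    rw [Complex.norm_real, Real.norm_eq_abs, abs_of_nonneg (Real.log_nonneg (by
      linarith [Real.pi_gt_three]))]
    have := Real.log_le_sub_one_of_pos Real.pi_pos
    linarith [Real.pi_lt_four]
  have h2π : ‖(1 / (2 * π) : ℂ)‖ ≤ 1 := by
    rw [show (1 / (2 * π) : ℂ) = ((1 / (2 * π) : ℝ) : ℂ) by push_cast; ring, Complex.norm_real,
      Real.norm_eq_abs, abs_of_nonneg (by positivity)]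
    rw [div_le_one (by positivity)]
    linarith [Real.pi_gt_three]
  have hW : weilFunctional K =
      weilPolarTerm K - weilPrimeTerm K + ((1 / (2 * π) : ℂ) * weilArchIntegral K -
        K 0 * (Real.log π : ℂ)) := rfl
  calc ‖weilFunctional K‖
      ≤ ‖weilPolarTerm K‖ + ‖weilPrimeTerm K‖ + (‖(1 / (2 * π) : ℂ)‖ * ‖weilArchIntegral K‖ +
          ‖K 0‖ * ‖(Real.log π : ℂ)‖) := by
        rw [hW]
        refine (norm_add_le _ _).trans (add_le_add (norm_sub_le _ _) ?_)
        refine (norm_sub_le _ _).trans (add_le_add ?_ ?_)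
        · rw [norm_mul]
        · rw [norm_mul]
    _ ≤ ‖weilPolarTerm K‖ + ‖weilPrimeTerm K‖ + (1 * ‖weilArchIntegral K‖ + ‖K 0‖ * 3) := by
        gcongr
    _ ≤ C₁ * S * N + (C₂ * S * (N + N') + C₁ * S * N * 3) := by
        have hK0 : ‖K 0‖ ≤ C₁ * S * N := by
          have := hPP
          linarith [norm_nonneg (weilPolarTerm K), norm_nonneg (weilPrimeTerm K)]
        have hPP' : ‖weilPolarTerm K‖ + ‖weilPrimeTerm K‖ ≤ C₁ * S * N := by
          linarith [norm_nonneg (K 0)]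
        rw [one_mul]
        gcongr
    _ ≤ (4 * C₁ + C₂) * S * (N + N') := by
        have h1 : C₁ * S * N ≤ C₁ * S * (N + N') :=
          mul_le_mul_of_nonneg_left (le_add_of_nonneg_right hN'0) (by positivity)
        nlinarith [h1, mul_nonneg (mul_nonneg hC₁ hS0) hN0]

end PairContinuity

/-! ## §2. The window primitive of a non-trivial combination of an orthonormal pair is non-zero -/

section Nonzero

variable {a : ℝ} {u₁ u₂ : ℝ → ℂ} {c₁ c₂ : ℂ}

/-- **`U ≠ 0` in `L²`.** Let `u₁, u₂` be ground states at window `a` with `∫ conj u₁ · u₂ = 0`,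
`(c₁, c₂) ≠ (0, 0)` and `∫ (c₂u₁ − c₁u₂) = 0`.  Then the window primitive
`U(t) = ∫_{-a}^t (c₂u₁ − c₁u₂)` has `0 < ∫ |U|²`.  (If `∫|U|² = 0` the continuous `U` vanishes
identically, so every interval integral of `c₂u₁ − c₁u₂` vanishes and `c₂u₁ = c₁u₂` a.e.
(Lebesgue differentiation); pairing with `conj u₁` gives `c₂ = 0`, then `|c₁|² = ∫|c₁u₂|² = 0`.)
[folklore] -/
theorem integral_norm_sq_primitive_pos (hu₁ : IsWeilGroundState a u₁)
    (hu₂ : IsWeilGroundState a u₂) (horth : ∫ t, starRingEnd ℂ (u₁ t) * u₂ t = 0)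
    (hc : c₁ ≠ 0 ∨ c₂ ≠ 0) (hG0 : ∫ t, (c₂ * u₁ t - c₁ * u₂ t) = 0) :
    0 < ∫ t, ‖∫ s in (-a)..t, (c₂ * u₁ s - c₁ * u₂ s)‖ ^ 2 := by
  have ha : 0 < a := hu₁.pos
  set G : ℝ → ℂ := fun t ↦ c₂ * u₁ t - c₁ * u₂ t with hG
  have hGm : MemLp G 2 := (hu₁.memLp.const_mul c₂).sub (hu₂.memLp.const_mul c₁)
  have hGz : ∀ᵐ t : ℝ, t ∉ Icc (-a) a → G t = 0 := by
    filter_upwards [hu₁.ae_eq_zero_of_notMem, hu₂.ae_eq_zero_of_notMem] with t h1 h2 ht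
    simp only [hG]
    rw [h1 ht, h2 ht, mul_zero, mul_zero, sub_zero]
  have hGi : Integrable G := integrable_of_memLp_two_window hGm hGz
  set U : ℝ → ℂ := fun t ↦ ∫ s in (-a)..t, G s with hU
  have hUc : Continuous U :=
    intervalIntegral.continuous_primitive (fun _ _ ↦ hGi.intervalIntegrable) (-a)
  have hUm : MemLp U 2 := memLp_two_primitive_window ha.le hGi hGz hG0
  by_contra hnot
  have hz : ∫ t, ‖U t‖ ^ 2 = 0 :=
    le_antisymm (not_lt.1 hnot) (integral_nonneg fun _ ↦ by positivity)
  have hint : Integrable fun t ↦ ‖U t‖ ^ 2 := (memLp_two_iff_integrable_sq_norm hUm.1).1 hUm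
  have hae0 := (integral_eq_zero_iff_of_nonneg (fun t ↦ by positivity) hint).1 hz
  have hU0ae : U =ᵐ[volume] 0 := hae0.mono fun t ht ↦ by
    have h1 : ‖U t‖ ^ 2 = 0 := ht
    simpa using h1
  have hU0 : U = 0 := (Continuous.ae_eq_iff_eq volume hUc continuous_zero).1 hU0ae
  -- all interval integrals of `G` vanish, so `G = 0` a.e.
  have hG0ae : G =ᵐ[volume] 0 := by
    refine ConnesVanSuijlekom.ae_eq_zero_of_forall_intervalIntegral_eq_zero hGi fun s t _ ↦ ?_
    have h1 : (∫ x in (-a)..t, G x) - ∫ x in (-a)..s, G x = ∫ x in s..t, G x :=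
      intervalIntegral.integral_interval_sub_left hGi.intervalIntegrable hGi.intervalIntegrable
    have h2 : U t = 0 := by rw [hU0]; rfl
    have h3 : U s = 0 := by rw [hU0]; rfl
    rw [← h1]
    change U t - U s = 0
    rw [h2, h3, sub_zero]
  -- `c₂ = 0`: pair `G = 0` with `conj u₁`
  have hi₁ : Integrable fun t ↦ u₁ t * conj (u₁ t) :=
    hu₁.memLp.integrable_mul (ConnesVanSuijlekom.memLp_conj hu₁.memLp)
  have hi₂ : Integrable fun t ↦ u₂ t * conj (u₁ t) :=
    hu₂.memLp.integrable_mul (ConnesVanSuijlekom.memLp_conj hu₁.memLp)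
  have hc₂ : c₂ = 0 := by
    have h0 : ∫ t, G t * conj (u₁ t) = 0 := by
      rw [integral_congr_ae (hG0ae.mono fun t ht ↦ show G t * conj (u₁ t) = (0 : ℝ → ℂ) t by
        simp [ht])]
      simp
    have h1 : ∫ t, G t * conj (u₁ t) =
        c₂ * (∫ t, u₁ t * conj (u₁ t)) - c₁ * ∫ t, u₂ t * conj (u₁ t) := by
      rw [← integral_const_mul, ← integral_const_mul,
        ← integral_sub (hi₁.const_mul _) (hi₂.const_mul _)]
      congr 1 with t
      simp only [hG]
      ring
    have h2 : ∫ t, u₁ t * conj (u₁ t) = 1 := by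
      rw [ConnesVanSuijlekom.integral_mul_conj_self, hu₁.integral_norm_sq]
      simp
    have h3 : ∫ t, u₂ t * conj (u₁ t) = 0 := by
      simp_rw [mul_comm (u₂ _)]
      exact horth
    rw [h1, h2, h3] at h0
    simpa using h0
  -- `c₁ = 0`: `‖c₁‖² = ∫ |G|² = 0`
  have hc₁ : c₁ = 0 := by
    have h0 : ∫ t, ‖G t‖ ^ 2 = 0 := by
      rw [integral_congr_ae (hG0ae.mono fun t ht ↦ show ‖G t‖ ^ 2 = (0 : ℝ → ℝ) t by simp [ht])]
      simp
    have h1 : ∫ t, ‖G t‖ ^ 2 = ‖c₁‖ ^ 2 := by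
      simp only [hG, hc₂, zero_mul, zero_sub, norm_neg, norm_mul, mul_pow]
      rw [integral_const_mul, hu₂.integral_norm_sq, mul_one]
    rw [h1] at h0
    exact norm_eq_zero.1 (pow_eq_zero_iff two_ne_zero |>.1 h0)
  exact hc.elim (fun h ↦ h hc₁) (fun h ↦ h hc₂)

end Nonzero

end Summit.RiemannHypothesis.RiemannHypothesis.Theorems.GroundStateSimpleEven

namespace Summit.RiemannHypothesis.RiemannHypothesis.Theorems

open Literature.NumberTheory.LFunctions

set_option linter.dupNamespace false in
/-- **Registered sub-goal of stub PAIR: pair continuity of the Weil form on `L² × H¹` of the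
window.** For `a > 0` there is `C ≥ 0` with `‖W(f ⋆ h̃)‖ ≤ C ‖f‖₂ (‖h‖₂ + ‖h'‖₂)` for all window
test functions `f, h` (`GroundStateSimpleEven.exists_norm_weilFunctional_pair_le`, from (PC1)
p135583 and (PC2) p135667). [folklore] -/
theorem stub_pairContinuity :
    ∀ a : ℝ, 0 < a → ∃ C : ℝ, 0 ≤ C ∧ ∀ f h : ℝ → ℂ, IsWeilTest f → tsupport f ⊆ Icc (-a) a →
      IsWeilTest h → tsupport h ⊆ Icc (-a) a →
        ‖weilFunctional (weilConv f (weilReflect h))‖ ≤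
          C * √(∫ t, ‖f t‖ ^ 2) * (√(∫ t, ‖h t‖ ^ 2) + √(∫ t, ‖deriv h t‖ ^ 2)) :=
  fun _ ha => GroundStateSimpleEven.exists_norm_weilFunctional_pair_le ha

set_option linter.dupNamespace false in
/-- **Registered sub-goal of stub PAIR: the window primitive of a non-trivial mean-zero combination
of an orthogonal pair of ground states is non-zero in `L²`**
(`GroundStateSimpleEven.integral_norm_sq_primitive_pos`). [folklore] -/
theorem stub_windowPrimitive_ne_zero :
    ∀ a : ℝ, ∀ u₁ u₂ : ℝ → ℂ, IsWeilGroundState a u₁ → IsWeilGroundState a u₂ →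
      ∫ t, starRingEnd ℂ (u₁ t) * u₂ t = 0 → ∀ c₁ c₂ : ℂ, (c₁ ≠ 0 ∨ c₂ ≠ 0) →
      ∫ t, (c₂ * u₁ t - c₁ * u₂ t) = 0 →
        0 < ∫ t, ‖∫ s in (-a)..t, (c₂ * u₁ s - c₁ * u₂ s)‖ ^ 2 :=
  fun _ _ _ hu₁ hu₂ horth _ _ hc hG0 =>
    GroundStateSimpleEven.integral_norm_sq_primitive_pos hu₁ hu₂ horth hc hG0

end Summit.RiemannHypothesis.RiemannHypothesis.Theorems

end
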